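import Mathlib
import Summits.ValiantsHypothesis.ValiantsHypothesis.Theorems.ValuativeGCTValuativeFlipPencilBorderTools
import Summits.ValiantsHypothesis.ValiantsHypothesis.Theorems.ValuativeGCTValuativeFlipGenericBorderFamily

/-!
# The size transfer `N ↦ N+3`, step 2: the linear-algebra lower bound for the span of the initial forms
# (crux `ValuativeGCT.ValuativeFlip`, stmt-ValiantsHypothesis-12624; wall-breaker axis k8 gen 1, seat 2)

Helper file (`--supports stmt-ValiantsHypothesis-12624`), line `four-row-count` (AXIS k8g1 seat 2, §1 L).
The lowest-order family `H` of `st_initial_forms` consists of `P₂⁰ ·` (block 1's own border family `F₁`) and of the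
products `U = {(y_s per B₁) · g, 2Λ₁ · g : g ∈ {R²⁰_k, C²⁰_l}}`.  For any ring map `φ` into a field with
`φ(P₂⁰) ≠ 0`:  `finrank(φF₁) + finrank(φ(U ∪ P₂⁰·T)) ≤ finrank(φH) + finrank(φ(P₂⁰·T))`, where `T` is the set of
monomials with exponents `≤ N₁+4` (every multiple of `φP₂⁰` inside `span φU` has its cofactor there, by degree)
— `st_lower_bound`. [this crux, line four-row-count; folklore linear algebra]
-/

set_option linter.dupNamespace false
set_option maxHeartbeats 1600000

namespace Summit.ValiantsHypothesis.ValiantsHypothesis.Theorems.ValuativeFlip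

open scoped BigOperators
open MvPolynomial Matrix

/-- Total degree of a permanent whose entries have total degree `≤ 1`. [folklore] -/
theorem st_totalDegree_permanent_le {K : Type*} [CommRing K] {ι σ : Type*} [Fintype ι] [DecidableEq ι] (M : Matrix ι ι (MvPolynomial σ K)) (hM : ∀ i j, (M i j).totalDegree ≤ 1) : M.permanent.totalDegree ≤ Fintype.card ι := by
  unfold Matrix.permanent
  refine (totalDegree_finsetSum _ _).trans (Finset.sup_le fun σ' _ => ?_)
  refine (totalDegree_finsetProd _ _).trans ?_
  calc ∑ i, (M (σ' i) i).totalDegree ≤ ∑ _i : ι, 1 := Finset.sum_le_sum fun i _ => hM _ _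
    _ = Fintype.card ι := by simp

/-- `X s` has total degree `≤ 1` (also over the zero ring). [folklore] -/
theorem st_totalDegree_X_le {K : Type*} [CommRing K] {σ : Type*} (s : σ) : (X s : MvPolynomial σ K).totalDegree ≤ 1 := by
  rcases subsingleton_or_nontrivial K with h | h
  · have : (X s : MvPolynomial σ K) = 0 := Subsingleton.elim _ _
    rw [this, totalDegree_zero]
    exact Nat.zero_le _
  · exact (totalDegree_X (R := K) s).le

/-- A linear form `Σ_s a_s • X_s` has total degree `≤ 1`. [folklore] -/
theorem st_totalDegree_linForm_le {K : Type*} [CommRing K] (a : Fin 3 → K) :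
    (∑ s : Fin 3, a s • (X s : MvPolynomial (Fin 3) K)).totalDegree ≤ 1 := by
  refine (totalDegree_finsetSum _ _).trans (Finset.sup_le fun s _ => ?_)
  exact (totalDegree_smul_le _ _).trans (st_totalDegree_X_le s)

/-- `map` does not increase the total degree. [folklore] -/
theorem st_totalDegree_map_le {K L : Type*} [CommRing K] [CommRing L] {σ : Type*} (f : K →+* L) (p : MvPolynomial σ K) :
    (MvPolynomial.map f p).totalDegree ≤ p.totalDegree :=
  Finset.sup_mono (support_map_subset (f := f) p)

/-- A polynomial of total degree `≤ D` times `P` lies in the span of the `P`-multiples of the monomials with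
exponents `≤ D`. [folklore] -/
theorem st_mul_mem_span_monomials {F : Type*} [Field F] (P a : (MvPolynomial (Fin 3) F)) (D : ℕ) (ha : a.totalDegree ≤ D) :
    P * a ∈ Submodule.span F (Set.range fun ex : Fin 3 → Fin (D + 1) =>
      P * MvPolynomial.monomial (Finsupp.equivFunOnFinite.symm fun s : Fin 3 => ((ex s : Fin (D + 1)) : ℕ)) (1 : F)) := by
  rw [a.as_sum, Finset.mul_sum]
  refine Submodule.sum_mem _ fun m hm => ?_
  have hmD : ∀ s, m s ≤ D := fun s =>
    ((degreeOf_le_iff.mp (degreeOf_le_totalDegree a s)) m hm).trans ha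
  have hmon : MvPolynomial.monomial m (coeff m a) = coeff m a • MvPolynomial.monomial m (1 : F) := by
    rw [smul_monomial, smul_eq_mul, mul_one]
  rw [hmon, mul_smul_comm]
  refine Submodule.smul_mem _ _ (Submodule.subset_span ⟨fun s => ⟨m s, Nat.lt_succ_of_le (hmD s)⟩, ?_⟩)
  simp only
  congr 2
  ext s
  simp

/-- **Linear-algebra lower bound for the span of the initial forms** (AXIS §1 L):
`finrank(φF₁) + finrank(φ(U ∪ P₂⁰T)) ≤ finrank(φH) + finrank(φ(P₂⁰T))`. [this crux, line four-row-count] -/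
theorem st_lower_bound {R F : Type*} [CommRing R] [Field F] (φ : R →+* F) (t c₂ : ℕ → ℕ → Fin 3 → R) (n₁ k : ℕ)
    (hP : MvPolynomial.map φ ((Matrix.of fun i j : Fin 3 => ∑ s : Fin 3, (if i = j then (0 : R) else c₂ (i : ℕ) (j : ℕ) s) • (X s : MvPolynomial (Fin 3) R))).permanent ≠ 0) :
    Module.finrank F ↥(Submodule.span F (Set.range fun i : (Fin 3 ⊕ ((Fin 3 × Fin (n₁ + k + 1)) ⊕ ((Fin 3 × Fin (n₁ + k + 1)) ⊕ (Fin (n₁ + k + 1) ⊕ Fin (n₁ + k + 1))))) => MvPolynomial.map φ ((Sum.elim (fun s : Fin 3 => (X s : MvPolynomial (Fin 3) R) * ((Matrix.of fun i j : Fin (n₁ + k + 1) => (fun ij : Fin (n₁ + k + 1) × Fin (n₁ + k + 1) => ∑ s : Fin 3, (if ((ij.1 : ℕ) = (ij.2 : ℕ) ∧ n₁ + 1 ≤ (ij.1 : ℕ)) then (0 : R) else t (ij.1 : ℕ) (ij.2 : ℕ) s) • (X s : MvPolynomial (Fin 3) R)) (i, j))).permanent) (Sum.elim (fun sk : Fin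 3 × Fin (n₁ + k + 1) => (X sk.1 : MvPolynomial (Fin 3) R) * (((Matrix.of fun i j : Fin (n₁ + k + 1) => (fun ij : Fin (n₁ + k + 1) × Fin (n₁ + k + 1) => ∑ s : Fin 3, (if ((ij.1 : ℕ) = (ij.2 : ℕ) ∧ n₁ + 1 ≤ (ij.1 : ℕ)) then (0 : R) else t (ij.1 : ℕ) (ij.2 : ℕ) s) • (X s : MvPolynomial (Fin 3) R)) (i, j))).updateRow sk.2 (fun l : Fin (n₁ + k + 1) => ∑ s : Fin 3, t (n₁ + k + 1 + 3) ((l : Fin (n₁ + k + 1)) : ℕ) s • (X s : MvPolynomial (Fin 3) R))).permanent) (Sum.elim (fun sl : Fin 3 × Fin (n₁ + k + 1) => (X sl.1 : MvPolynomial (Fin 3) R) * (((Matrix.of fun i j : Fin (n₁ + k + 1) => (fun ij : Fin (n₁ + k + 1) × Fin (n₁ + k + 1) => ∑ s : Fin 3, (if ((ij.1 : ℕ) = (ij.2 : ℕ) ∧ n₁ + 1 ≤ (ij.1 : ℕ)) then (0 : R) else t (ij.1 : ℕ) (ij.2 : ℕ) s) • (X s : MvPolynomial (Fin 3) R)) (i,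 j))).updateCol sl.2 (fun i : Fin (n₁ + k + 1) => ∑ s : Fin 3, t ((i : Fin (n₁ + k + 1)) : ℕ) (n₁ + k + 1 + 3) s • (X s : MvPolynomial (Fin 3) R))).permanent) (Sum.elim (fun k₁ : Fin (n₁ + k + 1) => (((Matrix.fromBlocks (Matrix.of fun i j : Fin (n₁ + k + 1) => (fun ij : Fin (n₁ + k + 1) × Fin (n₁ + k + 1) => ∑ s : Fin 3, (if ((ij.1 : ℕ) = (ij.2 : ℕ) ∧ n₁ + 1 ≤ (ij.1 : ℕ)) then (0 : R) else t (ij.1 : ℕ) (ij.2 : ℕ) s) • (X s : MvPolynomial (Fin 3) R)) (i, j)) (Matrix.of fun (i : Fin (n₁ + k + 1)) (_ : Unit) => (fun i : Fin (n₁ + k + 1) => ∑ s : Fin 3, t ((i : Fin (n₁ + k + 1)) : ℕ) (n₁ + k + 1 + 3) s • (X s : MvPolynomial (Fin 3) R)) i) (Matrix.of fun (_ : Unit) (j : Fin (n₁ + k + 1)) => (fun l : Fin (n₁ + k + 1) => ∑ s : Fin 3, t (n₁ + k + 1 + 3) ((l : Fin (n₁ + k + 1)) : ℕ) s • (X s :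 MvPolynomial (Fin 3) R)) j) (0 : Matrix Unit Unit (MvPolynomial (Fin 3) R)))).updateRow (Sum.inl k₁) (((Matrix.fromBlocks (Matrix.of fun i j : Fin (n₁ + k + 1) => (fun ij : Fin (n₁ + k + 1) × Fin (n₁ + k + 1) => ∑ s : Fin 3, (if ((ij.1 : ℕ) = (ij.2 : ℕ) ∧ n₁ + 1 ≤ (ij.1 : ℕ)) then (0 : R) else t (ij.1 : ℕ) (ij.2 : ℕ) s) • (X s : MvPolynomial (Fin 3) R)) (i, j)) (Matrix.of fun (i : Fin (n₁ + k + 1)) (_ : Unit) => (fun i : Fin (n₁ + k + 1) => ∑ s : Fin 3, t ((i : Fin (n₁ + k + 1)) : ℕ) (n₁ + k + 1 + 3) s • (X s : MvPolynomial (Fin 3) R)) i) (Matrix.of fun (_ : Unit) (j : Fin (n₁ + k + 1)) => (fun l : Fin (n₁ + k + 1) => ∑ s : Fin 3, t (n₁ + k + 1 + 3) ((l : Fin (n₁ + k + 1)) : ℕ) s • (X s : MvPolynomial (Fin 3) R)) j) (0 : Matrix Unit Unit (MvPolynomial (Fin 3) R)))) (Sum.inr ()))).permanent) (fun l₁ :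 Fin (n₁ + k + 1) => (((Matrix.fromBlocks (Matrix.of fun i j : Fin (n₁ + k + 1) => (fun ij : Fin (n₁ + k + 1) × Fin (n₁ + k + 1) => ∑ s : Fin 3, (if ((ij.1 : ℕ) = (ij.2 : ℕ) ∧ n₁ + 1 ≤ (ij.1 : ℕ)) then (0 : R) else t (ij.1 : ℕ) (ij.2 : ℕ) s) • (X s : MvPolynomial (Fin 3) R)) (i, j)) (Matrix.of fun (i : Fin (n₁ + k + 1)) (_ : Unit) => (fun i : Fin (n₁ + k + 1) => ∑ s : Fin 3, t ((i : Fin (n₁ + k + 1)) : ℕ) (n₁ + k + 1 + 3) s • (X s : MvPolynomial (Fin 3) R)) i) (Matrix.of fun (_ : Unit) (j : Fin (n₁ + k + 1)) => (fun l : Fin (n₁ + k + 1) => ∑ s : Fin 3, t (n₁ + k + 1 + 3) ((l : Fin (n₁ + k + 1)) : ℕ) s • (X s : MvPolynomial (Fin 3) R)) j) (0 : Matrix Unit Unit (MvPolynomial (Fin 3) R)))).updateCol (Sum.inl l₁) (fun i => ((Matrix.fromBlocks (Matrix.of fun i j : Fin (n₁ + k + 1) => (fun ij : Fin (n₁ +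 k + 1) × Fin (n₁ + k + 1) => ∑ s : Fin 3, (if ((ij.1 : ℕ) = (ij.2 : ℕ) ∧ n₁ + 1 ≤ (ij.1 : ℕ)) then (0 : R) else t (ij.1 : ℕ) (ij.2 : ℕ) s) • (X s : MvPolynomial (Fin 3) R)) (i, j)) (Matrix.of fun (i : Fin (n₁ + k + 1)) (_ : Unit) => (fun i : Fin (n₁ + k + 1) => ∑ s : Fin 3, t ((i : Fin (n₁ + k + 1)) : ℕ) (n₁ + k + 1 + 3) s • (X s : MvPolynomial (Fin 3) R)) i) (Matrix.of fun (_ : Unit) (j : Fin (n₁ + k + 1)) => (fun l : Fin (n₁ + k + 1) => ∑ s : Fin 3, t (n₁ + k + 1 + 3) ((l : Fin (n₁ + k + 1)) : ℕ) s • (X s : MvPolynomial (Fin 3) R)) j) (0 : Matrix Unit Unit (MvPolynomial (Fin 3) R)))) i (Sum.inr ()))).permanent))))) i))) +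
    Module.finrank F ↥(Submodule.span F (Set.range fun i : ((Fin 3 × Fin 3) ⊕ ((Fin 3 × Fin 3) ⊕ (Fin 3 ⊕ Fin 3))) ⊕ (Fin 3 → Fin ((n₁ + k + 1 + 4) + 1)) => MvPolynomial.map φ ((Sum.elim (Sum.elim (fun sk : Fin 3 × Fin 3 => ((X sk.1 : MvPolynomial (Fin 3) R) * ((Matrix.of fun i j : Fin (n₁ + k + 1) => (fun ij : Fin (n₁ + k + 1) × Fin (n₁ + k + 1) => ∑ s : Fin 3, (if ((ij.1 : ℕ) = (ij.2 : ℕ) ∧ n₁ + 1 ≤ (ij.1 : ℕ)) then (0 : R) else t (ij.1 : ℕ) (ij.2 : ℕ) s) • (X s : MvPolynomial (Fin 3) R)) (i, j))).permanent) * (((Matrix.of fun i j : Fin 3 => ∑ s : Fin 3, (if i = j then (0 : R) else c₂ (i : ℕ) (j : ℕ) s) • (X s : MvPolynomial (Fin 3) R))).updateRow sk.2 (fun l : Fin 3 => ∑ s : Fin 3, c₂ 3 ((l : Fin 3) : ℕ) s • (X s : MvPolynomial (Fin 3) R))).permanent) (Sum.elim (fun sl : Fin 3 × Fin 3 => ((X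 sl.1 : MvPolynomial (Fin 3) R) * ((Matrix.of fun i j : Fin (n₁ + k + 1) => (fun ij : Fin (n₁ + k + 1) × Fin (n₁ + k + 1) => ∑ s : Fin 3, (if ((ij.1 : ℕ) = (ij.2 : ℕ) ∧ n₁ + 1 ≤ (ij.1 : ℕ)) then (0 : R) else t (ij.1 : ℕ) (ij.2 : ℕ) s) • (X s : MvPolynomial (Fin 3) R)) (i, j))).permanent) * (((Matrix.of fun i j : Fin 3 => ∑ s : Fin 3, (if i = j then (0 : R) else c₂ (i : ℕ) (j : ℕ) s) • (X s : MvPolynomial (Fin 3) R))).updateCol sl.2 (fun i : Fin 3 => ∑ s : Fin 3, c₂ ((i : Fin 3) : ℕ) 3 s • (X s : MvPolynomial (Fin 3) R))).permanent) (Sum.elim (fun k₂ : Fin 3 => 2 * ((Matrix.fromBlocks (Matrix.of fun i j : Fin (n₁ + k + 1) => (fun ij : Fin (n₁ + k + 1) × Fin (n₁ + k + 1) => ∑ s : Fin 3, (if ((ij.1 : ℕ) = (ij.2 : ℕ) ∧ n₁ + 1 ≤ (ij.1 : ℕ)) then (0 : R) else t (ij.1 : ℕ) (ij.2 : ℕ)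 s) • (X s : MvPolynomial (Fin 3) R)) (i, j)) (Matrix.of fun (i : Fin (n₁ + k + 1)) (_ : Unit) => (fun i : Fin (n₁ + k + 1) => ∑ s : Fin 3, t ((i : Fin (n₁ + k + 1)) : ℕ) (n₁ + k + 1 + 3) s • (X s : MvPolynomial (Fin 3) R)) i) (Matrix.of fun (_ : Unit) (j : Fin (n₁ + k + 1)) => (fun l : Fin (n₁ + k + 1) => ∑ s : Fin 3, t (n₁ + k + 1 + 3) ((l : Fin (n₁ + k + 1)) : ℕ) s • (X s : MvPolynomial (Fin 3) R)) j) (0 : Matrix Unit Unit (MvPolynomial (Fin 3) R)))).permanent * (((Matrix.of fun i j : Fin 3 => ∑ s : Fin 3, (if i = j then (0 : R) else c₂ (i : ℕ) (j : ℕ) s) • (X s : MvPolynomial (Fin 3) R))).updateRow k₂ (fun l : Fin 3 => ∑ s : Fin 3, c₂ 3 ((l : Fin 3) : ℕ) s • (X s : MvPolynomial (Fin 3) R))).permanent) (fun l₂ : Fin 3 => 2 * ((Matrix.fromBlocks (Matrix.of fun i j : Fin (n₁ + k + 1) => (fun ij : Fin (n₁ + k + 1) × Fin (n₁ + k + 1)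 => ∑ s : Fin 3, (if ((ij.1 : ℕ) = (ij.2 : ℕ) ∧ n₁ + 1 ≤ (ij.1 : ℕ)) then (0 : R) else t (ij.1 : ℕ) (ij.2 : ℕ) s) • (X s : MvPolynomial (Fin 3) R)) (i, j)) (Matrix.of fun (i : Fin (n₁ + k + 1)) (_ : Unit) => (fun i : Fin (n₁ + k + 1) => ∑ s : Fin 3, t ((i : Fin (n₁ + k + 1)) : ℕ) (n₁ + k + 1 + 3) s • (X s : MvPolynomial (Fin 3) R)) i) (Matrix.of fun (_ : Unit) (j : Fin (n₁ + k + 1)) => (fun l : Fin (n₁ + k + 1) => ∑ s : Fin 3, t (n₁ + k + 1 + 3) ((l : Fin (n₁ + k + 1)) : ℕ) s • (X s : MvPolynomial (Fin 3) R)) j) (0 : Matrix Unit Unit (MvPolynomial (Fin 3) R)))).permanent * (((Matrix.of fun i j : Fin 3 => ∑ s : Fin 3, (if i = j then (0 : R) else c₂ (i : ℕ) (j : ℕ) s) • (X s : MvPolynomial (Fin 3) R))).updateCol l₂ (fun i : Fin 3 => ∑ s : Fin 3, c₂ ((i : Fin 3) : ℕ) 3 s • (X s : MvPolynomial (Fin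 3) R))).permanent)))) (fun ex : Fin 3 → Fin ((n₁ + k + 1 + 4) + 1) => ((Matrix.of fun i j : Fin 3 => ∑ s : Fin 3, (if i = j then (0 : R) else c₂ (i : ℕ) (j : ℕ) s) • (X s : MvPolynomial (Fin 3) R))).permanent * MvPolynomial.monomial (Finsupp.equivFunOnFinite.symm fun s : Fin 3 => ((ex s : Fin ((n₁ + k + 1 + 4) + 1)) : ℕ)) (1 : R))) i))) ≤
    Module.finrank F ↥(Submodule.span F (Set.range fun idx : (Fin 3 ⊕ ((Fin 3 × Fin (n₁ + k + 1 + 3)) ⊕ ((Fin 3 × Fin (n₁ + k + 1 + 3)) ⊕ (Fin (n₁ + k + 1 + 3) ⊕ Fin (n₁ + k + 1 + 3))))) => MvPolynomial.map φ ((Sum.elim (fun s : Fin 3 => ((Matrix.of fun i j : Fin 3 => ∑ s : Fin 3, (if i = j then (0 : R) else c₂ (i : ℕ) (j : ℕ) s) • (X s : MvPolynomial (Fin 3) R))).permanent * ((X s : MvPolynomial (Fin 3) R) * ((Matrix.of fun i j : Fin (n₁ + k + 1) => (fun ij : Fin (n₁ + k + 1) × Fin (n₁ + k + 1) => ∑ s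 : Fin 3, (if ((ij.1 : ℕ) = (ij.2 : ℕ) ∧ n₁ + 1 ≤ (ij.1 : ℕ)) then (0 : R) else t (ij.1 : ℕ) (ij.2 : ℕ) s) • (X s : MvPolynomial (Fin 3) R)) (i, j))).permanent)) (Sum.elim (fun sk : Fin 3 × Fin (n₁ + k + 1 + 3) => Sum.elim (fun k₁ : Fin (n₁ + k + 1) => ((Matrix.of fun i j : Fin 3 => ∑ s : Fin 3, (if i = j then (0 : R) else c₂ (i : ℕ) (j : ℕ) s) • (X s : MvPolynomial (Fin 3) R))).permanent * ((X sk.1 : MvPolynomial (Fin 3) R) * (((Matrix.of fun i j : Fin (n₁ + k + 1) => (fun ij : Fin (n₁ + k + 1) × Fin (n₁ + k + 1) => ∑ s : Fin 3, (if ((ij.1 : ℕ) = (ij.2 : ℕ) ∧ n₁ + 1 ≤ (ij.1 : ℕ)) then (0 : R) else t (ij.1 : ℕ) (ij.2 : ℕ) s) • (X s : MvPolynomial (Fin 3) R)) (i, j))).updateRow k₁ (fun l : Fin (n₁ + k + 1) => ∑ s : Fin 3, t (n₁ + k + 1 + 3) ((l : Fin (n₁ + k + 1)) : ℕ) s • (X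 s : MvPolynomial (Fin 3) R))).permanent)) (fun k₂ : Fin 3 => ((X sk.1 : MvPolynomial (Fin 3) R) * ((Matrix.of fun i j : Fin (n₁ + k + 1) => (fun ij : Fin (n₁ + k + 1) × Fin (n₁ + k + 1) => ∑ s : Fin 3, (if ((ij.1 : ℕ) = (ij.2 : ℕ) ∧ n₁ + 1 ≤ (ij.1 : ℕ)) then (0 : R) else t (ij.1 : ℕ) (ij.2 : ℕ) s) • (X s : MvPolynomial (Fin 3) R)) (i, j))).permanent) * (((Matrix.of fun i j : Fin 3 => ∑ s : Fin 3, (if i = j then (0 : R) else c₂ (i : ℕ) (j : ℕ) s) • (X s : MvPolynomial (Fin 3) R))).updateRow k₂ (fun l : Fin 3 => ∑ s : Fin 3, c₂ 3 ((l : Fin 3) : ℕ) s • (X s : MvPolynomial (Fin 3) R))).permanent) (((finSumFinEquiv : Fin (n₁ + k + 1) ⊕ Fin 3 ≃ Fin (n₁ + k + 1 + 3))).symm sk.2)) (Sum.elim (fun sl : Fin 3 × Fin (n₁ + k + 1 + 3) => Sum.elim (fun l₁ : Fin (n₁ + k + 1) => ((Matrix.of fun i j : Fin 3 => ∑ s :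 Fin 3, (if i = j then (0 : R) else c₂ (i : ℕ) (j : ℕ) s) • (X s : MvPolynomial (Fin 3) R))).permanent * ((X sl.1 : MvPolynomial (Fin 3) R) * (((Matrix.of fun i j : Fin (n₁ + k + 1) => (fun ij : Fin (n₁ + k + 1) × Fin (n₁ + k + 1) => ∑ s : Fin 3, (if ((ij.1 : ℕ) = (ij.2 : ℕ) ∧ n₁ + 1 ≤ (ij.1 : ℕ)) then (0 : R) else t (ij.1 : ℕ) (ij.2 : ℕ) s) • (X s : MvPolynomial (Fin 3) R)) (i, j))).updateCol l₁ (fun i : Fin (n₁ + k + 1) => ∑ s : Fin 3, t ((i : Fin (n₁ + k + 1)) : ℕ) (n₁ + k + 1 + 3) s • (X s : MvPolynomial (Fin 3) R))).permanent)) (fun l₂ : Fin 3 => ((X sl.1 : MvPolynomial (Fin 3) R) * ((Matrix.of fun i j : Fin (n₁ + k + 1) => (fun ij : Fin (n₁ + k + 1) × Fin (n₁ + k + 1) => ∑ s : Fin 3, (if ((ij.1 : ℕ) = (ij.2 : ℕ) ∧ n₁ + 1 ≤ (ij.1 : ℕ)) then (0 : R) else t (ij.1 : ℕ) (ij.2 :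 ℕ) s) • (X s : MvPolynomial (Fin 3) R)) (i, j))).permanent) * (((Matrix.of fun i j : Fin 3 => ∑ s : Fin 3, (if i = j then (0 : R) else c₂ (i : ℕ) (j : ℕ) s) • (X s : MvPolynomial (Fin 3) R))).updateCol l₂ (fun i : Fin 3 => ∑ s : Fin 3, c₂ ((i : Fin 3) : ℕ) 3 s • (X s : MvPolynomial (Fin 3) R))).permanent) (((finSumFinEquiv : Fin (n₁ + k + 1) ⊕ Fin 3 ≃ Fin (n₁ + k + 1 + 3))).symm sl.2)) (Sum.elim (fun k' : Fin (n₁ + k + 1 + 3) => Sum.elim (fun k₁ : Fin (n₁ + k + 1) => ((Matrix.of fun i j : Fin 3 => ∑ s : Fin 3, (if i = j then (0 : R) else c₂ (i : ℕ) (j : ℕ) s) • (X s : MvPolynomial (Fin 3) R))).permanent * (((Matrix.fromBlocks (Matrix.of fun i j : Fin (n₁ + k + 1) => (fun ij : Fin (n₁ + k + 1) × Fin (n₁ + k + 1) => ∑ s : Fin 3, (if ((ij.1 : ℕ) = (ij.2 : ℕ) ∧ n₁ + 1 ≤ (ij.1 : ℕ)) then (0 : R) else t (ij.1 : ℕ)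 (ij.2 : ℕ) s) • (X s : MvPolynomial (Fin 3) R)) (i, j)) (Matrix.of fun (i : Fin (n₁ + k + 1)) (_ : Unit) => (fun i : Fin (n₁ + k + 1) => ∑ s : Fin 3, t ((i : Fin (n₁ + k + 1)) : ℕ) (n₁ + k + 1 + 3) s • (X s : MvPolynomial (Fin 3) R)) i) (Matrix.of fun (_ : Unit) (j : Fin (n₁ + k + 1)) => (fun l : Fin (n₁ + k + 1) => ∑ s : Fin 3, t (n₁ + k + 1 + 3) ((l : Fin (n₁ + k + 1)) : ℕ) s • (X s : MvPolynomial (Fin 3) R)) j) (0 : Matrix Unit Unit (MvPolynomial (Fin 3) R)))).updateRow (Sum.inl k₁) (((Matrix.fromBlocks (Matrix.of fun i j : Fin (n₁ + k + 1) => (fun ij : Fin (n₁ + k + 1) × Fin (n₁ + k + 1) => ∑ s : Fin 3, (if ((ij.1 : ℕ) = (ij.2 : ℕ) ∧ n₁ + 1 ≤ (ij.1 : ℕ)) then (0 : R) else t (ij.1 : ℕ) (ij.2 : ℕ) s) • (X s : MvPolynomial (Fin 3) R)) (i, j)) (Matrix.of fun (i : Fin (n₁ + k + 1)) (_ : Unit)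 => (fun i : Fin (n₁ + k + 1) => ∑ s : Fin 3, t ((i : Fin (n₁ + k + 1)) : ℕ) (n₁ + k + 1 + 3) s • (X s : MvPolynomial (Fin 3) R)) i) (Matrix.of fun (_ : Unit) (j : Fin (n₁ + k + 1)) => (fun l : Fin (n₁ + k + 1) => ∑ s : Fin 3, t (n₁ + k + 1 + 3) ((l : Fin (n₁ + k + 1)) : ℕ) s • (X s : MvPolynomial (Fin 3) R)) j) (0 : Matrix Unit Unit (MvPolynomial (Fin 3) R)))) (Sum.inr ()))).permanent) (fun k₂ : Fin 3 => 2 * ((Matrix.fromBlocks (Matrix.of fun i j : Fin (n₁ + k + 1) => (fun ij : Fin (n₁ + k + 1) × Fin (n₁ + k + 1) => ∑ s : Fin 3, (if ((ij.1 : ℕ) = (ij.2 : ℕ) ∧ n₁ + 1 ≤ (ij.1 : ℕ)) then (0 : R) else t (ij.1 : ℕ) (ij.2 : ℕ) s) • (X s : MvPolynomial (Fin 3) R)) (i, j)) (Matrix.of fun (i : Fin (n₁ + k + 1)) (_ : Unit) => (fun i : Fin (n₁ + k + 1) => ∑ s : Fin 3, t ((i : Fin (n₁ + k + 1)) : ℕ)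 (n₁ + k + 1 + 3) s • (X s : MvPolynomial (Fin 3) R)) i) (Matrix.of fun (_ : Unit) (j : Fin (n₁ + k + 1)) => (fun l : Fin (n₁ + k + 1) => ∑ s : Fin 3, t (n₁ + k + 1 + 3) ((l : Fin (n₁ + k + 1)) : ℕ) s • (X s : MvPolynomial (Fin 3) R)) j) (0 : Matrix Unit Unit (MvPolynomial (Fin 3) R)))).permanent * (((Matrix.of fun i j : Fin 3 => ∑ s : Fin 3, (if i = j then (0 : R) else c₂ (i : ℕ) (j : ℕ) s) • (X s : MvPolynomial (Fin 3) R))).updateRow k₂ (fun l : Fin 3 => ∑ s : Fin 3, c₂ 3 ((l : Fin 3) : ℕ) s • (X s : MvPolynomial (Fin 3) R))).permanent) (((finSumFinEquiv : Fin (n₁ + k + 1) ⊕ Fin 3 ≃ Fin (n₁ + k + 1 + 3))).symm k')) (fun l : Fin (n₁ + k + 1 + 3) => Sum.elim (fun l₁ : Fin (n₁ + k + 1) => ((Matrix.of fun i j : Fin 3 => ∑ s : Fin 3, (if i = j then (0 : R) else c₂ (i : ℕ) (j : ℕ) s) • (X s : MvPolynomial (Fin 3) R))).permanent * (((Matrix.fromBlocks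 (Matrix.of fun i j : Fin (n₁ + k + 1) => (fun ij : Fin (n₁ + k + 1) × Fin (n₁ + k + 1) => ∑ s : Fin 3, (if ((ij.1 : ℕ) = (ij.2 : ℕ) ∧ n₁ + 1 ≤ (ij.1 : ℕ)) then (0 : R) else t (ij.1 : ℕ) (ij.2 : ℕ) s) • (X s : MvPolynomial (Fin 3) R)) (i, j)) (Matrix.of fun (i : Fin (n₁ + k + 1)) (_ : Unit) => (fun i : Fin (n₁ + k + 1) => ∑ s : Fin 3, t ((i : Fin (n₁ + k + 1)) : ℕ) (n₁ + k + 1 + 3) s • (X s : MvPolynomial (Fin 3) R)) i) (Matrix.of fun (_ : Unit) (j : Fin (n₁ + k + 1)) => (fun l : Fin (n₁ + k + 1) => ∑ s : Fin 3, t (n₁ + k + 1 + 3) ((l : Fin (n₁ + k + 1)) : ℕ) s • (X s : MvPolynomial (Fin 3) R)) j) (0 : Matrix Unit Unit (MvPolynomial (Fin 3) R)))).updateCol (Sum.inl l₁) (fun i => ((Matrix.fromBlocks (Matrix.of fun i j : Fin (n₁ + k + 1) => (fun ij : Fin (n₁ + k + 1) × Fin (n₁ + k + 1) => ∑ s : Fin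 3, (if ((ij.1 : ℕ) = (ij.2 : ℕ) ∧ n₁ + 1 ≤ (ij.1 : ℕ)) then (0 : R) else t (ij.1 : ℕ) (ij.2 : ℕ) s) • (X s : MvPolynomial (Fin 3) R)) (i, j)) (Matrix.of fun (i : Fin (n₁ + k + 1)) (_ : Unit) => (fun i : Fin (n₁ + k + 1) => ∑ s : Fin 3, t ((i : Fin (n₁ + k + 1)) : ℕ) (n₁ + k + 1 + 3) s • (X s : MvPolynomial (Fin 3) R)) i) (Matrix.of fun (_ : Unit) (j : Fin (n₁ + k + 1)) => (fun l : Fin (n₁ + k + 1) => ∑ s : Fin 3, t (n₁ + k + 1 + 3) ((l : Fin (n₁ + k + 1)) : ℕ) s • (X s : MvPolynomial (Fin 3) R)) j) (0 : Matrix Unit Unit (MvPolynomial (Fin 3) R)))) i (Sum.inr ()))).permanent) (fun l₂ : Fin 3 => 2 * ((Matrix.fromBlocks (Matrix.of fun i j : Fin (n₁ + k + 1) => (fun ij : Fin (n₁ + k + 1) × Fin (n₁ + k + 1) => ∑ s : Fin 3, (if ((ij.1 : ℕ) = (ij.2 : ℕ) ∧ n₁ + 1 ≤ (ij.1 : ℕ))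 then (0 : R) else t (ij.1 : ℕ) (ij.2 : ℕ) s) • (X s : MvPolynomial (Fin 3) R)) (i, j)) (Matrix.of fun (i : Fin (n₁ + k + 1)) (_ : Unit) => (fun i : Fin (n₁ + k + 1) => ∑ s : Fin 3, t ((i : Fin (n₁ + k + 1)) : ℕ) (n₁ + k + 1 + 3) s • (X s : MvPolynomial (Fin 3) R)) i) (Matrix.of fun (_ : Unit) (j : Fin (n₁ + k + 1)) => (fun l : Fin (n₁ + k + 1) => ∑ s : Fin 3, t (n₁ + k + 1 + 3) ((l : Fin (n₁ + k + 1)) : ℕ) s • (X s : MvPolynomial (Fin 3) R)) j) (0 : Matrix Unit Unit (MvPolynomial (Fin 3) R)))).permanent * (((Matrix.of fun i j : Fin 3 => ∑ s : Fin 3, (if i = j then (0 : R) else c₂ (i : ℕ) (j : ℕ) s) • (X s : MvPolynomial (Fin 3) R))).updateCol l₂ (fun i : Fin 3 => ∑ s : Fin 3, c₂ ((i : Fin 3) : ℕ) 3 s • (X s : MvPolynomial (Fin 3) R))).permanent) (((finSumFinEquiv : Fin (n₁ + k + 1) ⊕ Fin 3 ≃ Fin (n₁ + k + 1 + 3))).symm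 l)))))) idx))) +
    Module.finrank F ↥(Submodule.span F (Set.range fun ex : Fin 3 → Fin ((n₁ + k + 1 + 4) + 1) => MvPolynomial.map φ ((fun ex : Fin 3 → Fin ((n₁ + k + 1 + 4) + 1) => ((Matrix.of fun i j : Fin 3 => ∑ s : Fin 3, (if i = j then (0 : R) else c₂ (i : ℕ) (j : ℕ) s) • (X s : MvPolynomial (Fin 3) R))).permanent * MvPolynomial.monomial (Finsupp.equivFunOnFinite.symm fun s : Fin 3 => ((ex s : Fin ((n₁ + k + 1 + 4) + 1)) : ℕ)) (1 : R)) ex))) := by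
  set f : MvPolynomial (Fin 3) R →+* (MvPolynomial (Fin 3) F) := MvPolynomial.map φ with hf
  set P : (MvPolynomial (Fin 3) F) := f ((Matrix.of fun i j : Fin 3 => ∑ s : Fin 3, (if i = j then (0 : R) else c₂ (i : ℕ) (j : ℕ) s) • (X s : MvPolynomial (Fin 3) R))).permanent with hPdef
  set F1 : (Fin 3 ⊕ ((Fin 3 × Fin (n₁ + k + 1)) ⊕ ((Fin 3 × Fin (n₁ + k + 1)) ⊕ (Fin (n₁ + k + 1) ⊕ Fin (n₁ + k + 1))))) → MvPolynomial (Fin 3) R := (Sum.elim (fun s : Fin 3 => (X s : MvPolynomial (Fin 3) R) * ((Matrix.of fun i j : Fin (n₁ + k + 1) => (fun ij : Fin (n₁ + k + 1) × Fin (n₁ + k + 1) => ∑ s : Fin 3, (if ((ij.1 : ℕ) = (ij.2 : ℕ) ∧ n₁ + 1 ≤ (ij.1 : ℕ)) then (0 : R) else t (ij.1 : ℕ) (ij.2 : ℕ) s) • (X s : MvPolynomial (Fin 3) R)) (i, j))).permanent) (Sum.elim (fun sk : Fin 3 × Fin (n₁ + k + 1) => (X sk.1 : MvPolynomial (Fin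 3) R) * (((Matrix.of fun i j : Fin (n₁ + k + 1) => (fun ij : Fin (n₁ + k + 1) × Fin (n₁ + k + 1) => ∑ s : Fin 3, (if ((ij.1 : ℕ) = (ij.2 : ℕ) ∧ n₁ + 1 ≤ (ij.1 : ℕ)) then (0 : R) else t (ij.1 : ℕ) (ij.2 : ℕ) s) • (X s : MvPolynomial (Fin 3) R)) (i, j))).updateRow sk.2 (fun l : Fin (n₁ + k + 1) => ∑ s : Fin 3, t (n₁ + k + 1 + 3) ((l : Fin (n₁ + k + 1)) : ℕ) s • (X s : MvPolynomial (Fin 3) R))).permanent) (Sum.elim (fun sl : Fin 3 × Fin (n₁ + k + 1) => (X sl.1 : MvPolynomial (Fin 3) R) * (((Matrix.of fun i j : Fin (n₁ + k + 1) => (fun ij : Fin (n₁ + k + 1) × Fin (n₁ + k + 1) => ∑ s : Fin 3, (if ((ij.1 : ℕ) = (ij.2 : ℕ) ∧ n₁ + 1 ≤ (ij.1 : ℕ)) then (0 : R) else t (ij.1 : ℕ) (ij.2 : ℕ) s) • (X s : MvPolynomial (Fin 3) R)) (i, j))).updateCol sl.2 (fun i : Fin (n₁ + k + 1) => ∑ s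 : Fin 3, t ((i : Fin (n₁ + k + 1)) : ℕ) (n₁ + k + 1 + 3) s • (X s : MvPolynomial (Fin 3) R))).permanent) (Sum.elim (fun k₁ : Fin (n₁ + k + 1) => (((Matrix.fromBlocks (Matrix.of fun i j : Fin (n₁ + k + 1) => (fun ij : Fin (n₁ + k + 1) × Fin (n₁ + k + 1) => ∑ s : Fin 3, (if ((ij.1 : ℕ) = (ij.2 : ℕ) ∧ n₁ + 1 ≤ (ij.1 : ℕ)) then (0 : R) else t (ij.1 : ℕ) (ij.2 : ℕ) s) • (X s : MvPolynomial (Fin 3) R)) (i, j)) (Matrix.of fun (i : Fin (n₁ + k + 1)) (_ : Unit) => (fun i : Fin (n₁ + k + 1) => ∑ s : Fin 3, t ((i : Fin (n₁ + k + 1)) : ℕ) (n₁ + k + 1 + 3) s • (X s : MvPolynomial (Fin 3) R)) i) (Matrix.of fun (_ : Unit) (j : Fin (n₁ + k + 1)) => (fun l : Fin (n₁ + k + 1) => ∑ s : Fin 3, t (n₁ + k + 1 + 3) ((l : Fin (n₁ + k + 1)) : ℕ) s • (X s : MvPolynomial (Fin 3) R)) j) (0 : Matrix Unit Unit (MvPolynomial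 (Fin 3) R)))).updateRow (Sum.inl k₁) (((Matrix.fromBlocks (Matrix.of fun i j : Fin (n₁ + k + 1) => (fun ij : Fin (n₁ + k + 1) × Fin (n₁ + k + 1) => ∑ s : Fin 3, (if ((ij.1 : ℕ) = (ij.2 : ℕ) ∧ n₁ + 1 ≤ (ij.1 : ℕ)) then (0 : R) else t (ij.1 : ℕ) (ij.2 : ℕ) s) • (X s : MvPolynomial (Fin 3) R)) (i, j)) (Matrix.of fun (i : Fin (n₁ + k + 1)) (_ : Unit) => (fun i : Fin (n₁ + k + 1) => ∑ s : Fin 3, t ((i : Fin (n₁ + k + 1)) : ℕ) (n₁ + k + 1 + 3) s • (X s : MvPolynomial (Fin 3) R)) i) (Matrix.of fun (_ : Unit) (j : Fin (n₁ + k + 1)) => (fun l : Fin (n₁ + k + 1) => ∑ s : Fin 3, t (n₁ + k + 1 + 3) ((l : Fin (n₁ + k + 1)) : ℕ) s • (X s : MvPolynomial (Fin 3) R)) j) (0 : Matrix Unit Unit (MvPolynomial (Fin 3) R)))) (Sum.inr ()))).permanent) (fun l₁ : Fin (n₁ + k + 1) => (((Matrix.fromBlocks (Matrix.of fun i j : Fin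 (n₁ + k + 1) => (fun ij : Fin (n₁ + k + 1) × Fin (n₁ + k + 1) => ∑ s : Fin 3, (if ((ij.1 : ℕ) = (ij.2 : ℕ) ∧ n₁ + 1 ≤ (ij.1 : ℕ)) then (0 : R) else t (ij.1 : ℕ) (ij.2 : ℕ) s) • (X s : MvPolynomial (Fin 3) R)) (i, j)) (Matrix.of fun (i : Fin (n₁ + k + 1)) (_ : Unit) => (fun i : Fin (n₁ + k + 1) => ∑ s : Fin 3, t ((i : Fin (n₁ + k + 1)) : ℕ) (n₁ + k + 1 + 3) s • (X s : MvPolynomial (Fin 3) R)) i) (Matrix.of fun (_ : Unit) (j : Fin (n₁ + k + 1)) => (fun l : Fin (n₁ + k + 1) => ∑ s : Fin 3, t (n₁ + k + 1 + 3) ((l : Fin (n₁ + k + 1)) : ℕ) s • (X s : MvPolynomial (Fin 3) R)) j) (0 : Matrix Unit Unit (MvPolynomial (Fin 3) R)))).updateCol (Sum.inl l₁) (fun i => ((Matrix.fromBlocks (Matrix.of fun i j : Fin (n₁ + k + 1) => (fun ij : Fin (n₁ + k + 1) × Fin (n₁ + k + 1) => ∑ s : Fin 3, (if ((ij.1 :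 ℕ) = (ij.2 : ℕ) ∧ n₁ + 1 ≤ (ij.1 : ℕ)) then (0 : R) else t (ij.1 : ℕ) (ij.2 : ℕ) s) • (X s : MvPolynomial (Fin 3) R)) (i, j)) (Matrix.of fun (i : Fin (n₁ + k + 1)) (_ : Unit) => (fun i : Fin (n₁ + k + 1) => ∑ s : Fin 3, t ((i : Fin (n₁ + k + 1)) : ℕ) (n₁ + k + 1 + 3) s • (X s : MvPolynomial (Fin 3) R)) i) (Matrix.of fun (_ : Unit) (j : Fin (n₁ + k + 1)) => (fun l : Fin (n₁ + k + 1) => ∑ s : Fin 3, t (n₁ + k + 1 + 3) ((l : Fin (n₁ + k + 1)) : ℕ) s • (X s : MvPolynomial (Fin 3) R)) j) (0 : Matrix Unit Unit (MvPolynomial (Fin 3) R)))) i (Sum.inr ()))).permanent))))) with hF1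
  set UG : ((Fin 3 × Fin 3) ⊕ ((Fin 3 × Fin 3) ⊕ (Fin 3 ⊕ Fin 3))) → MvPolynomial (Fin 3) R := (Sum.elim (fun sk : Fin 3 × Fin 3 => ((X sk.1 : MvPolynomial (Fin 3) R) * ((Matrix.of fun i j : Fin (n₁ + k + 1) => (fun ij : Fin (n₁ + k + 1) × Fin (n₁ + k + 1) => ∑ s : Fin 3, (if ((ij.1 : ℕ) = (ij.2 : ℕ) ∧ n₁ + 1 ≤ (ij.1 : ℕ)) then (0 : R) else t (ij.1 : ℕ) (ij.2 : ℕ) s) • (X s : MvPolynomial (Fin 3) R)) (i, j))).permanent) * (((Matrix.of fun i j : Fin 3 => ∑ s : Fin 3, (if i = j then (0 : R) else c₂ (i : ℕ) (j : ℕ) s) • (X s : MvPolynomial (Fin 3) R))).updateRow sk.2 (fun l : Fin 3 => ∑ s : Fin 3, c₂ 3 ((l : Fin 3) : ℕ) s • (X s : MvPolynomial (Fin 3) R))).permanent) (Sum.elim (fun sl : Fin 3 × Fin 3 => ((X sl.1 : MvPolynomial (Fin 3) R) * ((Matrix.of fun i j : Fin (n₁ + k + 1) => (fun ij : Fin (n₁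 + k + 1) × Fin (n₁ + k + 1) => ∑ s : Fin 3, (if ((ij.1 : ℕ) = (ij.2 : ℕ) ∧ n₁ + 1 ≤ (ij.1 : ℕ)) then (0 : R) else t (ij.1 : ℕ) (ij.2 : ℕ) s) • (X s : MvPolynomial (Fin 3) R)) (i, j))).permanent) * (((Matrix.of fun i j : Fin 3 => ∑ s : Fin 3, (if i = j then (0 : R) else c₂ (i : ℕ) (j : ℕ) s) • (X s : MvPolynomial (Fin 3) R))).updateCol sl.2 (fun i : Fin 3 => ∑ s : Fin 3, c₂ ((i : Fin 3) : ℕ) 3 s • (X s : MvPolynomial (Fin 3) R))).permanent) (Sum.elim (fun k₂ : Fin 3 => 2 * ((Matrix.fromBlocks (Matrix.of fun i j : Fin (n₁ + k + 1) => (fun ij : Fin (n₁ + k + 1) × Fin (n₁ + k + 1) => ∑ s : Fin 3, (if ((ij.1 : ℕ) = (ij.2 : ℕ) ∧ n₁ + 1 ≤ (ij.1 : ℕ)) then (0 : R) else t (ij.1 : ℕ) (ij.2 : ℕ) s) • (X s : MvPolynomial (Fin 3) R)) (i, j)) (Matrix.of fun (i : Fin (n₁ + k + 1)) (_ : Unit)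 => (fun i : Fin (n₁ + k + 1) => ∑ s : Fin 3, t ((i : Fin (n₁ + k + 1)) : ℕ) (n₁ + k + 1 + 3) s • (X s : MvPolynomial (Fin 3) R)) i) (Matrix.of fun (_ : Unit) (j : Fin (n₁ + k + 1)) => (fun l : Fin (n₁ + k + 1) => ∑ s : Fin 3, t (n₁ + k + 1 + 3) ((l : Fin (n₁ + k + 1)) : ℕ) s • (X s : MvPolynomial (Fin 3) R)) j) (0 : Matrix Unit Unit (MvPolynomial (Fin 3) R)))).permanent * (((Matrix.of fun i j : Fin 3 => ∑ s : Fin 3, (if i = j then (0 : R) else c₂ (i : ℕ) (j : ℕ) s) • (X s : MvPolynomial (Fin 3) R))).updateRow k₂ (fun l : Fin 3 => ∑ s : Fin 3, c₂ 3 ((l : Fin 3) : ℕ) s • (X s : MvPolynomial (Fin 3) R))).permanent) (fun l₂ : Fin 3 => 2 * ((Matrix.fromBlocks (Matrix.of fun i j : Fin (n₁ + k + 1) => (fun ij : Fin (n₁ + k + 1) × Fin (n₁ + k + 1) => ∑ s : Fin 3, (if ((ij.1 : ℕ) = (ij.2 : ℕ) ∧ n₁ + 1 ≤ (ij.1 :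 ℕ)) then (0 : R) else t (ij.1 : ℕ) (ij.2 : ℕ) s) • (X s : MvPolynomial (Fin 3) R)) (i, j)) (Matrix.of fun (i : Fin (n₁ + k + 1)) (_ : Unit) => (fun i : Fin (n₁ + k + 1) => ∑ s : Fin 3, t ((i : Fin (n₁ + k + 1)) : ℕ) (n₁ + k + 1 + 3) s • (X s : MvPolynomial (Fin 3) R)) i) (Matrix.of fun (_ : Unit) (j : Fin (n₁ + k + 1)) => (fun l : Fin (n₁ + k + 1) => ∑ s : Fin 3, t (n₁ + k + 1 + 3) ((l : Fin (n₁ + k + 1)) : ℕ) s • (X s : MvPolynomial (Fin 3) R)) j) (0 : Matrix Unit Unit (MvPolynomial (Fin 3) R)))).permanent * (((Matrix.of fun i j : Fin 3 => ∑ s : Fin 3, (if i = j then (0 : R) else c₂ (i : ℕ) (j : ℕ) s) • (X s : MvPolynomial (Fin 3) R))).updateCol l₂ (fun i : Fin 3 => ∑ s : Fin 3, c₂ ((i : Fin 3) : ℕ) 3 s • (X s : MvPolynomial (Fin 3) R))).permanent)))) with hUG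
  set PTG : (Fin 3 → Fin ((n₁ + k + 1 + 4) + 1)) → MvPolynomial (Fin 3) R := (fun ex : Fin 3 → Fin ((n₁ + k + 1 + 4) + 1) => ((Matrix.of fun i j : Fin 3 => ∑ s : Fin 3, (if i = j then (0 : R) else c₂ (i : ℕ) (j : ℕ) s) • (X s : MvPolynomial (Fin 3) R))).permanent * MvPolynomial.monomial (Finsupp.equivFunOnFinite.symm fun s : Fin 3 => ((ex s : Fin ((n₁ + k + 1 + 4) + 1)) : ℕ)) (1 : R)) with hPTG
  set HH : (Fin 3 ⊕ ((Fin 3 × Fin (n₁ + k + 1 + 3)) ⊕ ((Fin 3 × Fin (n₁ + k + 1 + 3)) ⊕ (Fin (n₁ + k + 1 + 3) ⊕ Fin (n₁ + k + 1 + 3))))) → MvPolynomial (Fin 3) R := (Sum.elim (fun s : Fin 3 => ((Matrix.of fun i j : Fin 3 => ∑ s : Fin 3, (if i = j then (0 : R) else c₂ (i : ℕ) (j : ℕ) s) • (X s : MvPolynomial (Fin 3) R))).permanent * ((X s : MvPolynomial (Fin 3) R) * ((Matrix.of fun i j : Fin (n₁ + k + 1) => (fun ij : Fin (n₁ + k +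 1) × Fin (n₁ + k + 1) => ∑ s : Fin 3, (if ((ij.1 : ℕ) = (ij.2 : ℕ) ∧ n₁ + 1 ≤ (ij.1 : ℕ)) then (0 : R) else t (ij.1 : ℕ) (ij.2 : ℕ) s) • (X s : MvPolynomial (Fin 3) R)) (i, j))).permanent)) (Sum.elim (fun sk : Fin 3 × Fin (n₁ + k + 1 + 3) => Sum.elim (fun k₁ : Fin (n₁ + k + 1) => ((Matrix.of fun i j : Fin 3 => ∑ s : Fin 3, (if i = j then (0 : R) else c₂ (i : ℕ) (j : ℕ) s) • (X s : MvPolynomial (Fin 3) R))).permanent * ((X sk.1 : MvPolynomial (Fin 3) R) * (((Matrix.of fun i j : Fin (n₁ + k + 1) => (fun ij : Fin (n₁ + k + 1) × Fin (n₁ + k + 1) => ∑ s : Fin 3, (if ((ij.1 : ℕ) = (ij.2 : ℕ) ∧ n₁ + 1 ≤ (ij.1 : ℕ)) then (0 : R) else t (ij.1 : ℕ) (ij.2 : ℕ) s) • (X s : MvPolynomial (Fin 3) R)) (i, j))).updateRow k₁ (fun l : Fin (n₁ + k + 1) => ∑ s : Fin 3, t (n₁ + k + 1 + 3) ((l : Fin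 (n₁ + k + 1)) : ℕ) s • (X s : MvPolynomial (Fin 3) R))).permanent)) (fun k₂ : Fin 3 => ((X sk.1 : MvPolynomial (Fin 3) R) * ((Matrix.of fun i j : Fin (n₁ + k + 1) => (fun ij : Fin (n₁ + k + 1) × Fin (n₁ + k + 1) => ∑ s : Fin 3, (if ((ij.1 : ℕ) = (ij.2 : ℕ) ∧ n₁ + 1 ≤ (ij.1 : ℕ)) then (0 : R) else t (ij.1 : ℕ) (ij.2 : ℕ) s) • (X s : MvPolynomial (Fin 3) R)) (i, j))).permanent) * (((Matrix.of fun i j : Fin 3 => ∑ s : Fin 3, (if i = j then (0 : R) else c₂ (i : ℕ) (j : ℕ) s) • (X s : MvPolynomial (Fin 3) R))).updateRow k₂ (fun l : Fin 3 => ∑ s : Fin 3, c₂ 3 ((l : Fin 3) : ℕ) s • (X s : MvPolynomial (Fin 3) R))).permanent) (((finSumFinEquiv : Fin (n₁ + k + 1) ⊕ Fin 3 ≃ Fin (n₁ + k + 1 + 3))).symm sk.2)) (Sum.elim (fun sl : Fin 3 × Fin (n₁ + k + 1 + 3) => Sum.elim (fun l₁ : Fin (n₁ + k + 1) => ((Matrix.of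 fun i j : Fin 3 => ∑ s : Fin 3, (if i = j then (0 : R) else c₂ (i : ℕ) (j : ℕ) s) • (X s : MvPolynomial (Fin 3) R))).permanent * ((X sl.1 : MvPolynomial (Fin 3) R) * (((Matrix.of fun i j : Fin (n₁ + k + 1) => (fun ij : Fin (n₁ + k + 1) × Fin (n₁ + k + 1) => ∑ s : Fin 3, (if ((ij.1 : ℕ) = (ij.2 : ℕ) ∧ n₁ + 1 ≤ (ij.1 : ℕ)) then (0 : R) else t (ij.1 : ℕ) (ij.2 : ℕ) s) • (X s : MvPolynomial (Fin 3) R)) (i, j))).updateCol l₁ (fun i : Fin (n₁ + k + 1) => ∑ s : Fin 3, t ((i : Fin (n₁ + k + 1)) : ℕ) (n₁ + k + 1 + 3) s • (X s : MvPolynomial (Fin 3) R))).permanent)) (fun l₂ : Fin 3 => ((X sl.1 : MvPolynomial (Fin 3) R) * ((Matrix.of fun i j : Fin (n₁ + k + 1) => (fun ij : Fin (n₁ + k + 1) × Fin (n₁ + k + 1) => ∑ s : Fin 3, (if ((ij.1 : ℕ) = (ij.2 : ℕ) ∧ n₁ + 1 ≤ (ij.1 : ℕ)) then (0 : R) else t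 (ij.1 : ℕ) (ij.2 : ℕ) s) • (X s : MvPolynomial (Fin 3) R)) (i, j))).permanent) * (((Matrix.of fun i j : Fin 3 => ∑ s : Fin 3, (if i = j then (0 : R) else c₂ (i : ℕ) (j : ℕ) s) • (X s : MvPolynomial (Fin 3) R))).updateCol l₂ (fun i : Fin 3 => ∑ s : Fin 3, c₂ ((i : Fin 3) : ℕ) 3 s • (X s : MvPolynomial (Fin 3) R))).permanent) (((finSumFinEquiv : Fin (n₁ + k + 1) ⊕ Fin 3 ≃ Fin (n₁ + k + 1 + 3))).symm sl.2)) (Sum.elim (fun k' : Fin (n₁ + k + 1 + 3) => Sum.elim (fun k₁ : Fin (n₁ + k + 1) => ((Matrix.of fun i j : Fin 3 => ∑ s : Fin 3, (if i = j then (0 : R) else c₂ (i : ℕ) (j : ℕ) s) • (X s : MvPolynomial (Fin 3) R))).permanent * (((Matrix.fromBlocks (Matrix.of fun i j : Fin (n₁ + k + 1) => (fun ij : Fin (n₁ + k + 1) × Fin (n₁ + k + 1) => ∑ s : Fin 3, (if ((ij.1 : ℕ) = (ij.2 : ℕ) ∧ n₁ + 1 ≤ (ij.1 : ℕ)) then (0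 : R) else t (ij.1 : ℕ) (ij.2 : ℕ) s) • (X s : MvPolynomial (Fin 3) R)) (i, j)) (Matrix.of fun (i : Fin (n₁ + k + 1)) (_ : Unit) => (fun i : Fin (n₁ + k + 1) => ∑ s : Fin 3, t ((i : Fin (n₁ + k + 1)) : ℕ) (n₁ + k + 1 + 3) s • (X s : MvPolynomial (Fin 3) R)) i) (Matrix.of fun (_ : Unit) (j : Fin (n₁ + k + 1)) => (fun l : Fin (n₁ + k + 1) => ∑ s : Fin 3, t (n₁ + k + 1 + 3) ((l : Fin (n₁ + k + 1)) : ℕ) s • (X s : MvPolynomial (Fin 3) R)) j) (0 : Matrix Unit Unit (MvPolynomial (Fin 3) R)))).updateRow (Sum.inl k₁) (((Matrix.fromBlocks (Matrix.of fun i j : Fin (n₁ + k + 1) => (fun ij : Fin (n₁ + k + 1) × Fin (n₁ + k + 1) => ∑ s : Fin 3, (if ((ij.1 : ℕ) = (ij.2 : ℕ) ∧ n₁ + 1 ≤ (ij.1 : ℕ)) then (0 : R) else t (ij.1 : ℕ) (ij.2 : ℕ) s) • (X s : MvPolynomial (Fin 3) R)) (i, j)) (Matrix.of fun (i : Fin (n₁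 + k + 1)) (_ : Unit) => (fun i : Fin (n₁ + k + 1) => ∑ s : Fin 3, t ((i : Fin (n₁ + k + 1)) : ℕ) (n₁ + k + 1 + 3) s • (X s : MvPolynomial (Fin 3) R)) i) (Matrix.of fun (_ : Unit) (j : Fin (n₁ + k + 1)) => (fun l : Fin (n₁ + k + 1) => ∑ s : Fin 3, t (n₁ + k + 1 + 3) ((l : Fin (n₁ + k + 1)) : ℕ) s • (X s : MvPolynomial (Fin 3) R)) j) (0 : Matrix Unit Unit (MvPolynomial (Fin 3) R)))) (Sum.inr ()))).permanent) (fun k₂ : Fin 3 => 2 * ((Matrix.fromBlocks (Matrix.of fun i j : Fin (n₁ + k + 1) => (fun ij : Fin (n₁ + k + 1) × Fin (n₁ + k + 1) => ∑ s : Fin 3, (if ((ij.1 : ℕ) = (ij.2 : ℕ) ∧ n₁ + 1 ≤ (ij.1 : ℕ)) then (0 : R) else t (ij.1 : ℕ) (ij.2 : ℕ) s) • (X s : MvPolynomial (Fin 3) R)) (i, j)) (Matrix.of fun (i : Fin (n₁ + k + 1)) (_ : Unit) => (fun i : Fin (n₁ + k + 1) => ∑ s : Fin 3, t ((i : Fin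 (n₁ + k + 1)) : ℕ) (n₁ + k + 1 + 3) s • (X s : MvPolynomial (Fin 3) R)) i) (Matrix.of fun (_ : Unit) (j : Fin (n₁ + k + 1)) => (fun l : Fin (n₁ + k + 1) => ∑ s : Fin 3, t (n₁ + k + 1 + 3) ((l : Fin (n₁ + k + 1)) : ℕ) s • (X s : MvPolynomial (Fin 3) R)) j) (0 : Matrix Unit Unit (MvPolynomial (Fin 3) R)))).permanent * (((Matrix.of fun i j : Fin 3 => ∑ s : Fin 3, (if i = j then (0 : R) else c₂ (i : ℕ) (j : ℕ) s) • (X s : MvPolynomial (Fin 3) R))).updateRow k₂ (fun l : Fin 3 => ∑ s : Fin 3, c₂ 3 ((l : Fin 3) : ℕ) s • (X s : MvPolynomial (Fin 3) R))).permanent) (((finSumFinEquiv : Fin (n₁ + k + 1) ⊕ Fin 3 ≃ Fin (n₁ + k + 1 + 3))).symm k')) (fun l : Fin (n₁ + k + 1 + 3) => Sum.elim (fun l₁ : Fin (n₁ + k + 1) => ((Matrix.of fun i j : Fin 3 => ∑ s : Fin 3, (if i = j then (0 : R) else c₂ (i : ℕ) (j : ℕ) s) • (X s : MvPolynomial (Fin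 3) R))).permanent * (((Matrix.fromBlocks (Matrix.of fun i j : Fin (n₁ + k + 1) => (fun ij : Fin (n₁ + k + 1) × Fin (n₁ + k + 1) => ∑ s : Fin 3, (if ((ij.1 : ℕ) = (ij.2 : ℕ) ∧ n₁ + 1 ≤ (ij.1 : ℕ)) then (0 : R) else t (ij.1 : ℕ) (ij.2 : ℕ) s) • (X s : MvPolynomial (Fin 3) R)) (i, j)) (Matrix.of fun (i : Fin (n₁ + k + 1)) (_ : Unit) => (fun i : Fin (n₁ + k + 1) => ∑ s : Fin 3, t ((i : Fin (n₁ + k + 1)) : ℕ) (n₁ + k + 1 + 3) s • (X s : MvPolynomial (Fin 3) R)) i) (Matrix.of fun (_ : Unit) (j : Fin (n₁ + k + 1)) => (fun l : Fin (n₁ + k + 1) => ∑ s : Fin 3, t (n₁ + k + 1 + 3) ((l : Fin (n₁ + k + 1)) : ℕ) s • (X s : MvPolynomial (Fin 3) R)) j) (0 : Matrix Unit Unit (MvPolynomial (Fin 3) R)))).updateCol (Sum.inl l₁) (fun i => ((Matrix.fromBlocks (Matrix.of fun i j : Fin (n₁ + k + 1) => (fun ij : Fin (n₁ + k + 1) ×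 Fin (n₁ + k + 1) => ∑ s : Fin 3, (if ((ij.1 : ℕ) = (ij.2 : ℕ) ∧ n₁ + 1 ≤ (ij.1 : ℕ)) then (0 : R) else t (ij.1 : ℕ) (ij.2 : ℕ) s) • (X s : MvPolynomial (Fin 3) R)) (i, j)) (Matrix.of fun (i : Fin (n₁ + k + 1)) (_ : Unit) => (fun i : Fin (n₁ + k + 1) => ∑ s : Fin 3, t ((i : Fin (n₁ + k + 1)) : ℕ) (n₁ + k + 1 + 3) s • (X s : MvPolynomial (Fin 3) R)) i) (Matrix.of fun (_ : Unit) (j : Fin (n₁ + k + 1)) => (fun l : Fin (n₁ + k + 1) => ∑ s : Fin 3, t (n₁ + k + 1 + 3) ((l : Fin (n₁ + k + 1)) : ℕ) s • (X s : MvPolynomial (Fin 3) R)) j) (0 : Matrix Unit Unit (MvPolynomial (Fin 3) R)))) i (Sum.inr ()))).permanent) (fun l₂ : Fin 3 => 2 * ((Matrix.fromBlocks (Matrix.of fun i j : Fin (n₁ + k + 1) => (fun ij : Fin (n₁ + k + 1) × Fin (n₁ + k + 1) => ∑ s : Fin 3, (if ((ij.1 : ℕ) = (ij.2 : ℕ)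 ∧ n₁ + 1 ≤ (ij.1 : ℕ)) then (0 : R) else t (ij.1 : ℕ) (ij.2 : ℕ) s) • (X s : MvPolynomial (Fin 3) R)) (i, j)) (Matrix.of fun (i : Fin (n₁ + k + 1)) (_ : Unit) => (fun i : Fin (n₁ + k + 1) => ∑ s : Fin 3, t ((i : Fin (n₁ + k + 1)) : ℕ) (n₁ + k + 1 + 3) s • (X s : MvPolynomial (Fin 3) R)) i) (Matrix.of fun (_ : Unit) (j : Fin (n₁ + k + 1)) => (fun l : Fin (n₁ + k + 1) => ∑ s : Fin 3, t (n₁ + k + 1 + 3) ((l : Fin (n₁ + k + 1)) : ℕ) s • (X s : MvPolynomial (Fin 3) R)) j) (0 : Matrix Unit Unit (MvPolynomial (Fin 3) R)))).permanent * (((Matrix.of fun i j : Fin 3 => ∑ s : Fin 3, (if i = j then (0 : R) else c₂ (i : ℕ) (j : ℕ) s) • (X s : MvPolynomial (Fin 3) R))).updateCol l₂ (fun i : Fin 3 => ∑ s : Fin 3, c₂ ((i : Fin 3) : ℕ) 3 s • (X s : MvPolynomial (Fin 3) R))).permanent) (((finSumFinEquiv : Fin (n₁ + k + 1) ⊕ Fin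 3 ≃ Fin (n₁ + k + 1 + 3))).symm l)))))) with hHH
  set A : Submodule F (MvPolynomial (Fin 3) F) := Submodule.span F (Set.range fun i => f (F1 i)) with hA
  set U : Submodule F (MvPolynomial (Fin 3) F) := Submodule.span F (Set.range fun i => f (UG i)) with hU
  set PT : Submodule F (MvPolynomial (Fin 3) F) := Submodule.span F (Set.range fun ex => f (PTG ex)) with hPT
  set μ : (MvPolynomial (Fin 3) F) →ₗ[F] (MvPolynomial (Fin 3) F) := LinearMap.mulLeft F P with hμ
  -- the spans in question
  have hW : Submodule.span F (Set.range fun i : ((Fin 3 × Fin 3) ⊕ ((Fin 3 × Fin 3) ⊕ (Fin 3 ⊕ Fin 3))) ⊕ (Fin 3 → Fin ((n₁ + k + 1 + 4) + 1)) => f ((Sum.elim UG PTG) i)) = U ⊔ PT := by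
    rw [show (fun i : ((Fin 3 × Fin 3) ⊕ ((Fin 3 × Fin 3) ⊕ (Fin 3 ⊕ Fin 3))) ⊕ (Fin 3 → Fin ((n₁ + k + 1 + 4) + 1)) => f ((Sum.elim UG PTG) i)) = Sum.elim (fun i => f (UG i)) (fun ex => f (PTG ex)) from by
      funext i; rcases i with i | i <;> rfl]
    exact gr_span_range_sumElim _ _
  have hHsup : Submodule.span F (Set.range fun idx => f (HH idx)) = A.map μ ⊔ U := by
    apply le_antisymm
    · rw [Submodule.span_le]
      rintro _ ⟨idx, rfl⟩
      have memA : ∀ i, μ (f (F1 i)) ∈ A.map μ ⊔ U := fun i =>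
        Submodule.mem_sup_left (Submodule.mem_map_of_mem (Submodule.subset_span ⟨i, rfl⟩))
      have memU : ∀ i, f (UG i) ∈ A.map μ ⊔ U := fun i => Submodule.mem_sup_right (Submodule.subset_span ⟨i, rfl⟩)
      rcases idx with s | ⟨s, kk⟩ | ⟨s, ll⟩ | kk | ll
      · have := memA (Sum.inl s)
        simpa [hHH, hF1, hμ, LinearMap.mulLeft_apply, hPdef, map_mul] using this
      · simp only [hHH, Sum.elim_inl, Sum.elim_inr]
        rcases ((finSumFinEquiv : Fin (n₁ + k + 1) ⊕ Fin 3 ≃ Fin (n₁ + k + 1 + 3))).symm kk with k₁ | k₂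
        · have := memA (Sum.inr (Sum.inl (s, k₁)))
          simpa [hF1, hμ, LinearMap.mulLeft_apply, hPdef, map_mul] using this
        · have := memU (Sum.inl (s, k₂))
          simpa [hUG, map_mul] using this
      · simp only [hHH, Sum.elim_inl, Sum.elim_inr]
        rcases ((finSumFinEquiv : Fin (n₁ + k + 1) ⊕ Fin 3 ≃ Fin (n₁ + k + 1 + 3))).symm ll with l₁ | l₂
        · have := memA (Sum.inr (Sum.inr (Sum.inl (s, l₁))))
          simpa [hF1, hμ, LinearMap.mulLeft_apply, hPdef, map_mul] using this
        · have := memU (Sum.inr (Sum.inl (s, l₂)))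
          simpa [hUG, map_mul] using this
      · simp only [hHH, Sum.elim_inl, Sum.elim_inr]
        rcases ((finSumFinEquiv : Fin (n₁ + k + 1) ⊕ Fin 3 ≃ Fin (n₁ + k + 1 + 3))).symm kk with k₁ | k₂
        · have := memA (Sum.inr (Sum.inr (Sum.inr (Sum.inl k₁))))
          simpa [hF1, hμ, LinearMap.mulLeft_apply, hPdef, map_mul] using this
        · have := memU (Sum.inr (Sum.inr (Sum.inl k₂)))
          simpa [hUG, map_mul] using this
      · simp only [hHH, Sum.elim_inr]
        rcases ((finSumFinEquiv : Fin (n₁ + k + 1) ⊕ Fin 3 ≃ Fin (n₁ + k + 1 + 3))).symm ll with l₁ | l₂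
        · have := memA (Sum.inr (Sum.inr (Sum.inr (Sum.inr l₁))))
          simpa [hF1, hμ, LinearMap.mulLeft_apply, hPdef, map_mul] using this
        · have := memU (Sum.inr (Sum.inr (Sum.inr l₂)))
          simpa [hUG, map_mul] using this
    · have memH : ∀ idx, f (HH idx) ∈ Submodule.span F (Set.range fun idx => f (HH idx)) :=
        fun idx => Submodule.subset_span ⟨idx, rfl⟩
      refine sup_le ?_ ?_
      · rw [Submodule.map_le_iff_le_comap, Submodule.span_le]
        rintro _ ⟨i, rfl⟩
        rw [SetLike.mem_coe, Submodule.mem_comap]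
        rcases i with s | ⟨s, k₁⟩ | ⟨s, l₁⟩ | k₁ | l₁
        · have := memH (Sum.inl s)
          simpa [hHH, hF1, hμ, LinearMap.mulLeft_apply, hPdef, map_mul] using this
        · have := memH (Sum.inr (Sum.inl (s, ((finSumFinEquiv : Fin (n₁ + k + 1) ⊕ Fin 3 ≃ Fin (n₁ + k + 1 + 3))) (Sum.inl k₁))))
          simpa [hHH, hF1, hμ, LinearMap.mulLeft_apply, hPdef, map_mul] using this
        · have := memH (Sum.inr (Sum.inr (Sum.inl (s, ((finSumFinEquiv : Fin (n₁ + k + 1) ⊕ Fin 3 ≃ Fin (n₁ + k + 1 + 3))) (Sum.inl l₁)))))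
          simpa [hHH, hF1, hμ, LinearMap.mulLeft_apply, hPdef, map_mul] using this
        · have := memH (Sum.inr (Sum.inr (Sum.inr (Sum.inl (((finSumFinEquiv : Fin (n₁ + k + 1) ⊕ Fin 3 ≃ Fin (n₁ + k + 1 + 3))) (Sum.inl k₁))))))
          simpa [hHH, hF1, hμ, LinearMap.mulLeft_apply, hPdef, map_mul] using this
        · have := memH (Sum.inr (Sum.inr (Sum.inr (Sum.inr (((finSumFinEquiv : Fin (n₁ + k + 1) ⊕ Fin 3 ≃ Fin (n₁ + k + 1 + 3))) (Sum.inl l₁))))))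
          simpa [hHH, hF1, hμ, LinearMap.mulLeft_apply, hPdef, map_mul] using this
      · rw [Submodule.span_le]
        rintro _ ⟨i, rfl⟩
        rcases i with ⟨s, k₂⟩ | ⟨s, l₂⟩ | k₂ | l₂
        · have := memH (Sum.inr (Sum.inl (s, ((finSumFinEquiv : Fin (n₁ + k + 1) ⊕ Fin 3 ≃ Fin (n₁ + k + 1 + 3))) (Sum.inr k₂))))
          simpa [hHH, hUG] using this
        · have := memH (Sum.inr (Sum.inr (Sum.inl (s, ((finSumFinEquiv : Fin (n₁ + k + 1) ⊕ Fin 3 ≃ Fin (n₁ + k + 1 + 3))) (Sum.inr l₂)))))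
          simpa [hHH, hUG] using this
        · have := memH (Sum.inr (Sum.inr (Sum.inr (Sum.inl (((finSumFinEquiv : Fin (n₁ + k + 1) ⊕ Fin 3 ≃ Fin (n₁ + k + 1 + 3))) (Sum.inr k₂))))))
          simpa [hHH, hUG] using this
        · have := memH (Sum.inr (Sum.inr (Sum.inr (Sum.inr (((finSumFinEquiv : Fin (n₁ + k + 1) ⊕ Fin 3 ≃ Fin (n₁ + k + 1 + 3))) (Sum.inr l₂))))))
          simpa [hHH, hUG] using this
  -- multiplication by `P ≠ 0` is injective
  have hμinj : Function.Injective μ := by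
    intro a b hab
    simp only [hμ, LinearMap.mulLeft_apply] at hab
    exact mul_left_cancel₀ hP hab
  have hfinA : Module.finrank F ↥(A.map μ) = Module.finrank F ↥A :=
    (LinearEquiv.finrank_eq (Submodule.equivMapOfInjective μ hμinj A)).symm
  -- degree bound for `U`
  have hdegU : ∀ u ∈ U, u.totalDegree ≤ (n₁ + k + 1 + 4) := by
    have hgen : ∀ i, (f (UG i)).totalDegree ≤ (n₁ + k + 1 + 4) := by
      have h1 : ∀ s : Fin 3, ((X s : MvPolynomial (Fin 3) R) * ((Matrix.of fun i j : Fin (n₁ + k + 1) => (fun ij : Fin (n₁ + k + 1) × Fin (n₁ + k + 1) => ∑ s : Fin 3, (if ((ij.1 : ℕ) = (ij.2 : ℕ) ∧ n₁ + 1 ≤ (ij.1 : ℕ)) then (0 : R) else t (ij.1 : ℕ) (ij.2 : ℕ) s) • (X s : MvPolynomial (Fin 3) R)) (i, j))).permanent).totalDegree ≤ 1 + (n₁ + k + 1) := by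
        intro s
        refine (totalDegree_mul _ _).trans (Nat.add_le_add ?_ ?_)
        · exact st_totalDegree_X_le s
        · refine (st_totalDegree_permanent_le _ fun i j => ?_).trans (by simp)
          rw [Matrix.of_apply]
          exact st_totalDegree_linForm_le _
      have h2 : (((Matrix.fromBlocks (Matrix.of fun i j : Fin (n₁ + k + 1) => (fun ij : Fin (n₁ + k + 1) × Fin (n₁ + k + 1) => ∑ s : Fin 3, (if ((ij.1 : ℕ) = (ij.2 : ℕ) ∧ n₁ + 1 ≤ (ij.1 : ℕ)) then (0 : R) else t (ij.1 : ℕ) (ij.2 : ℕ) s) • (X s : MvPolynomial (Fin 3) R)) (i, j)) (Matrix.of fun (i : Fin (n₁ + k + 1)) (_ : Unit) => (fun i : Fin (n₁ + k + 1) => ∑ s : Fin 3, t ((i : Fin (n₁ + k + 1)) : ℕ) (n₁ + k + 1 + 3) s • (X s : MvPolynomial (Fin 3) R)) i) (Matrix.of fun (_ : Unit) (j : Fin (n₁ + k + 1)) => (fun l : Fin (n₁ + k + 1) => ∑ s : Fin 3, t (n₁ + k + 1 + 3) ((l : Fin (n₁ + k + 1)) : ℕ) s • (X s : MvPolynomial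 (Fin 3) R)) j) (0 : Matrix Unit Unit (MvPolynomial (Fin 3) R)))).permanent).totalDegree ≤ (n₁ + k + 1) + 1 := by
        refine (st_totalDegree_permanent_le _ fun i j => ?_).trans (by simp)
        rcases i with i | i <;> rcases j with j | j
        · simp only [Matrix.fromBlocks_apply₁₁, Matrix.of_apply]; exact st_totalDegree_linForm_le _
        · simp only [Matrix.fromBlocks_apply₁₂, Matrix.of_apply]; exact st_totalDegree_linForm_le _
        · simp only [Matrix.fromBlocks_apply₂₁, Matrix.of_apply]; exact st_totalDegree_linForm_le _
        · simp only [Matrix.fromBlocks_apply₂₂, Matrix.zero_apply, totalDegree_zero]; exact Nat.zero_le _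
      have h3r : ∀ k₂ : Fin 3, ((((Matrix.of fun i j : Fin 3 => ∑ s : Fin 3, (if i = j then (0 : R) else c₂ (i : ℕ) (j : ℕ) s) • (X s : MvPolynomial (Fin 3) R))).updateRow k₂ (fun l : Fin 3 => ∑ s : Fin 3, c₂ 3 ((l : Fin 3) : ℕ) s • (X s : MvPolynomial (Fin 3) R))).permanent).totalDegree ≤ 3 := by
        intro k₂
        refine (st_totalDegree_permanent_le _ fun i j => ?_).trans (by simp)
        rw [Matrix.updateRow_apply]
        split_ifs
        · exact st_totalDegree_linForm_le _
        · rw [Matrix.of_apply]; exact st_totalDegree_linForm_le _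
      have h3c : ∀ l₂ : Fin 3, ((((Matrix.of fun i j : Fin 3 => ∑ s : Fin 3, (if i = j then (0 : R) else c₂ (i : ℕ) (j : ℕ) s) • (X s : MvPolynomial (Fin 3) R))).updateCol l₂ (fun i : Fin 3 => ∑ s : Fin 3, c₂ ((i : Fin 3) : ℕ) 3 s • (X s : MvPolynomial (Fin 3) R))).permanent).totalDegree ≤ 3 := by
        intro l₂
        refine (st_totalDegree_permanent_le _ fun i j => ?_).trans (by simp)
        rw [Matrix.updateCol_apply]
        split_ifs
        · exact st_totalDegree_linForm_le _
        · rw [Matrix.of_apply]; exact st_totalDegree_linForm_le _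
      have h2' : ((2 : MvPolynomial (Fin 3) R) * ((Matrix.fromBlocks (Matrix.of fun i j : Fin (n₁ + k + 1) => (fun ij : Fin (n₁ + k + 1) × Fin (n₁ + k + 1) => ∑ s : Fin 3, (if ((ij.1 : ℕ) = (ij.2 : ℕ) ∧ n₁ + 1 ≤ (ij.1 : ℕ)) then (0 : R) else t (ij.1 : ℕ) (ij.2 : ℕ) s) • (X s : MvPolynomial (Fin 3) R)) (i, j)) (Matrix.of fun (i : Fin (n₁ + k + 1)) (_ : Unit) => (fun i : Fin (n₁ + k + 1) => ∑ s : Fin 3, t ((i : Fin (n₁ + k + 1)) : ℕ) (n₁ + k + 1 + 3) s • (X s : MvPolynomial (Fin 3) R)) i) (Matrix.of fun (_ : Unit) (j : Fin (n₁ + k + 1)) => (fun l : Fin (n₁ + k + 1) => ∑ s : Fin 3, t (n₁ + k + 1 + 3) ((l : Fin (n₁ + k + 1)) : ℕ) s • (X s : MvPolynomial (Fin 3) R)) j) (0 : Matrix Unit Unit (MvPolynomial (Fin 3) R)))).permanent).totalDegree ≤ (n₁ + k + 1) + 1 := by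
        refine (totalDegree_mul _ _).trans ?_
        have : ((2 : MvPolynomial (Fin 3) R)).totalDegree = 0 := by
          rw [show (2 : MvPolynomial (Fin 3) R) = C 2 from (map_ofNat C 2).symm]; exact totalDegree_C _
        rw [this, zero_add]; exact h2
      intro i
      refine (st_totalDegree_map_le φ _).trans ?_
      rcases i with ⟨s, k₂⟩ | ⟨s, l₂⟩ | k₂ | l₂
      · show (((X s : MvPolynomial (Fin 3) R) * ((Matrix.of fun i j : Fin (n₁ + k + 1) => (fun ij : Fin (n₁ + k + 1) × Fin (n₁ + k + 1) => ∑ s : Fin 3, (if ((ij.1 : ℕ) = (ij.2 : ℕ) ∧ n₁ + 1 ≤ (ij.1 : ℕ)) then (0 : R) else t (ij.1 : ℕ) (ij.2 : ℕ) s) • (X s : MvPolynomial (Fin 3) R)) (i, j))).permanent) * (((Matrix.of fun i j : Fin 3 => ∑ s : Fin 3, (if i = j then (0 : R) else c₂ (i : ℕ) (j : ℕ) s) • (X s : MvPolynomial (Fin 3) R))).updateRow k₂ (fun l : Fin 3 => ∑ s : Fin 3, c₂ 3 ((l : Fin 3) : ℕ) s • (X s : MvPolynomial (Fin 3) R))).permanent).totalDegree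 ≤ (n₁ + k + 1 + 4)
        refine (totalDegree_mul _ _).trans ?_
        have := h1 s; have := h3r k₂; omega
      · show (((X s : MvPolynomial (Fin 3) R) * ((Matrix.of fun i j : Fin (n₁ + k + 1) => (fun ij : Fin (n₁ + k + 1) × Fin (n₁ + k + 1) => ∑ s : Fin 3, (if ((ij.1 : ℕ) = (ij.2 : ℕ) ∧ n₁ + 1 ≤ (ij.1 : ℕ)) then (0 : R) else t (ij.1 : ℕ) (ij.2 : ℕ) s) • (X s : MvPolynomial (Fin 3) R)) (i, j))).permanent) * (((Matrix.of fun i j : Fin 3 => ∑ s : Fin 3, (if i = j then (0 : R) else c₂ (i : ℕ) (j : ℕ) s) • (X s : MvPolynomial (Fin 3) R))).updateCol l₂ (fun i : Fin 3 => ∑ s : Fin 3, c₂ ((i : Fin 3) : ℕ) 3 s • (X s : MvPolynomial (Fin 3) R))).permanent).totalDegree ≤ (n₁ + k + 1 + 4)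
        refine (totalDegree_mul _ _).trans ?_
        have := h1 s; have := h3c l₂; omega
      · show ((2 * ((Matrix.fromBlocks (Matrix.of fun i j : Fin (n₁ + k + 1) => (fun ij : Fin (n₁ + k + 1) × Fin (n₁ + k + 1) => ∑ s : Fin 3, (if ((ij.1 : ℕ) = (ij.2 : ℕ) ∧ n₁ + 1 ≤ (ij.1 : ℕ)) then (0 : R) else t (ij.1 : ℕ) (ij.2 : ℕ) s) • (X s : MvPolynomial (Fin 3) R)) (i, j)) (Matrix.of fun (i : Fin (n₁ + k + 1)) (_ : Unit) => (fun i : Fin (n₁ + k + 1) => ∑ s : Fin 3, t ((i : Fin (n₁ + k + 1)) : ℕ) (n₁ + k + 1 + 3) s • (X s : MvPolynomial (Fin 3) R)) i) (Matrix.of fun (_ : Unit) (j : Fin (n₁ + k + 1)) => (fun l : Fin (n₁ + k + 1) => ∑ s : Fin 3, t (n₁ + k + 1 + 3) ((l : Fin (n₁ + k + 1)) : ℕ) s • (X s : MvPolynomial (Fin 3) R)) j) (0 : Matrix Unit Unit (MvPolynomial (Fin 3) R)))).permanent) * (((Matrix.of fun i j : Fin 3 => ∑ s : Fin 3, (if i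 = j then (0 : R) else c₂ (i : ℕ) (j : ℕ) s) • (X s : MvPolynomial (Fin 3) R))).updateRow k₂ (fun l : Fin 3 => ∑ s : Fin 3, c₂ 3 ((l : Fin 3) : ℕ) s • (X s : MvPolynomial (Fin 3) R))).permanent).totalDegree ≤ (n₁ + k + 1 + 4)
        refine (totalDegree_mul _ _).trans ?_
        have := h2'; have := h3r k₂; omega
      · show ((2 * ((Matrix.fromBlocks (Matrix.of fun i j : Fin (n₁ + k + 1) => (fun ij : Fin (n₁ + k + 1) × Fin (n₁ + k + 1) => ∑ s : Fin 3, (if ((ij.1 : ℕ) = (ij.2 : ℕ) ∧ n₁ + 1 ≤ (ij.1 : ℕ)) then (0 : R) else t (ij.1 : ℕ) (ij.2 : ℕ) s) • (X s : MvPolynomial (Fin 3) R)) (i, j)) (Matrix.of fun (i : Fin (n₁ + k + 1)) (_ : Unit) => (fun i : Fin (n₁ + k + 1) => ∑ s : Fin 3, t ((i : Fin (n₁ + k + 1)) : ℕ) (n₁ + k + 1 + 3) s • (X s : MvPolynomial (Fin 3) R)) i) (Matrix.of fun (_ : Unit) (j : Fin (n₁ + k + 1)) => (fun l : Fin (n₁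 + k + 1) => ∑ s : Fin 3, t (n₁ + k + 1 + 3) ((l : Fin (n₁ + k + 1)) : ℕ) s • (X s : MvPolynomial (Fin 3) R)) j) (0 : Matrix Unit Unit (MvPolynomial (Fin 3) R)))).permanent) * (((Matrix.of fun i j : Fin 3 => ∑ s : Fin 3, (if i = j then (0 : R) else c₂ (i : ℕ) (j : ℕ) s) • (X s : MvPolynomial (Fin 3) R))).updateCol l₂ (fun i : Fin 3 => ∑ s : Fin 3, c₂ ((i : Fin 3) : ℕ) 3 s • (X s : MvPolynomial (Fin 3) R))).permanent).totalDegree ≤ (n₁ + k + 1 + 4)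
        refine (totalDegree_mul _ _).trans ?_
        have := h2'; have := h3c l₂; omega
    intro u hu
    rw [hU] at hu
    refine Submodule.span_induction (p := fun u _ => u.totalDegree ≤ (n₁ + k + 1 + 4)) ?_ ?_ ?_ ?_ hu
    · rintro _ ⟨i, rfl⟩; exact hgen i
    · simp
    · intro a b _ _ ha hb; exact (totalDegree_add a b).trans (max_le ha hb)
    · intro c a _ ha; exact (totalDegree_smul_le c a).trans ha
  -- every multiple of `P` inside `U` has its cofactor among the monomials with exponents `≤ D`
  have hinf : A.map μ ⊓ U ≤ U ⊓ PT := by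
    intro u hu
    obtain ⟨hu1, hu2⟩ := Submodule.mem_inf.mp hu
    refine Submodule.mem_inf.mpr ⟨hu2, ?_⟩
    obtain ⟨a, -, rfl⟩ := Submodule.mem_map.mp hu1
    have hdeg : a.totalDegree ≤ (n₁ + k + 1 + 4) := by
      by_cases ha0 : a = 0
      · simp [ha0]
      · have hPa : (P * a).totalDegree = P.totalDegree + a.totalDegree := totalDegree_mul_of_isDomain hP ha0
        have := hdegU _ hu2
        simp only [hμ, LinearMap.mulLeft_apply] at this
        omega
    have hmem := st_mul_mem_span_monomials P a ((n₁ + k + 1 + 4)) hdeg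
    simp only [hμ, LinearMap.mulLeft_apply]
    refine (Submodule.span_mono ?_) hmem
    rintro _ ⟨ex, rfl⟩
    refine ⟨ex, ?_⟩
    show f (((Matrix.of fun i j : Fin 3 => ∑ s : Fin 3, (if i = j then (0 : R) else c₂ (i : ℕ) (j : ℕ) s) • (X s : MvPolynomial (Fin 3) R))).permanent * MvPolynomial.monomial (Finsupp.equivFunOnFinite.symm fun s : Fin 3 => ((ex s : Fin ((n₁ + k + 1 + 4) + 1)) : ℕ)) (1 : R)) = _
    rw [map_mul, ← hPdef, hf, map_monomial, map_one]
  -- dimension count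
  haveI : FiniteDimensional F ↥A := FiniteDimensional.span_of_finite F (Set.finite_range _)
  haveI : FiniteDimensional F ↥U := FiniteDimensional.span_of_finite F (Set.finite_range _)
  haveI : FiniteDimensional F ↥PT := FiniteDimensional.span_of_finite F (Set.finite_range _)
  haveI : FiniteDimensional F ↥(A.map μ) := Module.Finite.map _ _
  haveI : FiniteDimensional F ↥(U ⊓ PT) := Submodule.finiteDimensional_inf_left _ _
  haveI : FiniteDimensional F ↥(A.map μ ⊓ U) := Submodule.finiteDimensional_inf_left _ _
  have h1 := Submodule.finrank_sup_add_finrank_inf_eq (A.map μ) U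
  have h2 := Submodule.finrank_sup_add_finrank_inf_eq U PT
  have h3 : Module.finrank F ↥(A.map μ ⊓ U) ≤ Module.finrank F ↥(U ⊓ PT) := Submodule.finrank_mono hinf
  rw [hW, hHsup]
  omega

end Summit.ValiantsHypothesis.ValiantsHypothesis.Theorems.ValuativeFlip
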